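import Summits.FinalStateConjecture.FinalStateConjecture.Theorems.EIHFluxBalanceInertialRecessionStaircaseStep
import Summits.FinalStateConjecture.FinalStateConjecture.Theorems.EIHFluxBalanceInertialRecessionStaircaseFacts

/-!
# Route EIHFluxBalance — crux `InertialRecession` (E′), line `SketchCleanExcision`:
# the staircase, part 6 — the invariant, the base and the full step

Helper file for the crux `stmt-FinalStateConjecture-17403`
(`Summit.FinalStateConjecture.FinalStateConjecture.Theses.EIHFluxBalance.InertialRecession`), registered stub
`stub_integratedClusterBalance` (skeleton r12, `Cruxes/InertialRecession/Lines/SketchCleanExcision.lean`).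

With the window law `hWL`, the identification `hID` (error `ζ ≥ 0`, envelope `Z` on tails) and clean excision
`hE` all instantiated at the threshold `ρ = c_ρ·gsc` and clearance `1/8`, valid after the kinematic time `T ≥ 1`,
and a member set `S` isolated by `r` on `[t₁, t₂]`: the INVARIANT at a time `s₀ ∈ [t₁, t₂]` with gap scale `σ`
(floor `λ·isol s₀ ≤ σ`, ceiling `16σ ≤ isol s₀`) says that the total charge of the cover differs from
`kin S t₁` by at most `N·Z t₁ + B·∫_{t₁}^{s₀} (min (r s) s)^{-3/2}`. `staircase_base` (identification at `t₁`),
`staircase_advance` (one full step `σ/4`: static cost + two switches through the refinement, paid as `B·∫_step`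
via the Riemann lower bound of part 5). The last partial step and the induction are part 7
(`…StaircaseBound`). Mathlib only (plus parts 1–5). [folklore]
-/

noncomputable section

set_option linter.dupNamespace false

open scoped BigOperators Classical Topology
open Finset Filter MeasureTheory intervalIntegral

namespace Summit.FinalStateConjecture.FinalStateConjecture.Theorems.SublinearIsFree.Staircase

open Literature.Geometry.Lorentzian


variable {N : ℕ} {M : Fin N → ℝ} {ξ v : Fin N → ℝ → E3} {κ : ℝ} {P : ℝ → E3 → ℝ → Fin 4 → ℝ}
  {T C_W C_E c₀ lam cρ A B : ℝ} {ρ ζ Z : ℝ → ℝ} {S : Finset (Fin N)} {t₁ t₂ : ℝ} {r : ℝ → ℝ}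

/-! ### Elementary consequences of the constants -/

/-- `0 < c₀ ≤ 1` for `c₀ = (κ − κ²)/2`, `0 < κ < 1`. [folklore] -/
theorem c₀_pos_le (hκ : 0 < κ) (hκ1 : κ < 1) (hc₀ : c₀ = (κ - κ ^ 2) / 2) : 0 < c₀ ∧ c₀ ≤ 1 := by
  rw [hc₀]; constructor <;> nlinarith

/-- `0 < λ ≤ 1`. [folklore] -/
theorem lam_pos_le (hlam : lam = ((16 : ℝ) ^ (N ^ 2 + 1))⁻¹) : 0 < lam ∧ lam ≤ 1 := by
  rw [hlam]
  exact ⟨by positivity, inv_le_one_of_one_le₀ (one_le_pow₀ (by norm_num))⟩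

/-- `1 ≤ A`. [folklore] -/
theorem one_le_A (hlam : lam = ((16 : ℝ) ^ (N ^ 2 + 1))⁻¹) (hA : A = 2 / (lam * c₀)) (hc : 0 < c₀ ∧ c₀ ≤ 1) :
    1 ≤ A := by
  obtain ⟨hl0, hl1⟩ := lam_pos_le hlam
  obtain ⟨hc0, hc1⟩ := hc
  rw [hA, le_div_iff₀ (by positivity)]
  nlinarith [mul_le_mul hl1 hc1 hc0.le zero_le_one]

/-- `0 ≤ B` and `N·max(C_W,0)·A√A ≤ B`. [folklore] -/
theorem B_bounds (hκ : 0 < κ) (hκ1 : κ < 1) (hc₀ : c₀ = (κ - κ ^ 2) / 2) (hlam : lam = ((16 : ℝ) ^ (N ^ 2 + 1))⁻¹)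
    (hA : A = 2 / (lam * c₀)) (hB : B = N * max C_W 0 * (A * √A) + 2 * (N * C_E * (2 * A * √A / lam)))
    (hCE : 0 ≤ C_E) : 0 ≤ B ∧ N * max C_W 0 * (A * √A) ≤ B := by
  have hA1 := one_le_A hlam hA (c₀_pos_le hκ hκ1 hc₀)
  obtain ⟨hl0, -⟩ := lam_pos_le hlam
  have hA0 : 0 ≤ A := by linarith
  have h1 : 0 ≤ N * max C_W 0 * (A * √A) := by positivity
  have h2 : 0 ≤ 2 * (N * C_E * (2 * A * √A / lam)) := by positivity
  rw [hB]; constructor <;> linarith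

/-- The gap-scale floor in the form `λ·L ≤ σ`. [folklore] -/
theorem floor_of_gap (hlam : lam = ((16 : ℝ) ^ (N ^ 2 + 1))⁻¹) {L σ : ℝ} (h : L / 16 ^ (N ^ 2 + 1) ≤ σ) :
    lam * L ≤ σ := by
  rwa [hlam, inv_mul_eq_div]

/-- For `s ≥ t₁`: `min (c₀ t₁) 1 ≤ isol S s`, in particular `isol S s > 0`. [folklore] -/
theorem isol_floor (hκ : 0 < κ) (hκ1 : κ < 1) (hT1 : 1 ≤ T)
    (hsep1 : ∀ i j s, i ≠ j → T ≤ s → 1 ≤ ‖ξ i s - ξ j s‖) (hc₀ : c₀ = (κ - κ ^ 2) / 2) (ht₁ : T ≤ t₁)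
    {s : ℝ} (hs : t₁ ≤ s) : min (c₀ * t₁) 1 ≤ (Finset.fold min (c₀ * s) (fun pp ↦ ‖ξ (Prod.fst pp) s - ξ (Prod.snd pp) s‖) (S ×ˢ Sᶜ)) ∧ 0 < (Finset.fold min (c₀ * s) (fun pp ↦ ‖ξ (Prod.fst pp) s - ξ (Prod.snd pp) s‖) (S ×ˢ Sᶜ)) := by
  have hc := c₀_pos_le hκ hκ1 hc₀
  have h1 : min (c₀ * s) 1 ≤ (Finset.fold min (c₀ * s) (fun pp ↦ ‖ξ (Prod.fst pp) s - ξ (Prod.snd pp) s‖) (S ×ˢ Sᶜ)) := min_le_isol fun i j hij ↦ hsep1 i j s hij (ht₁.trans hs)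
  have h2 : min (c₀ * t₁) 1 ≤ min (c₀ * s) 1 := min_le_min (mul_le_mul_of_nonneg_left hs hc.1.le) le_rfl
  have h3 : 0 < min (c₀ * t₁) 1 := lt_min (mul_pos hc.1 (by linarith)) one_pos
  exact ⟨h2.trans h1, h3.trans_le (h2.trans h1)⟩

/-! ### The three moves -/

/-- **BASE**: a cover at `t₁` with the invariant (identification only). [folklore] -/
theorem staircase_base
    (hκ : 0 < κ)
    (hκ1 : κ < 1)
    (hT1 : 1 ≤ T)
    (hcone : ∀ i s, T ≤ s → ‖ξ i s‖ ≤ κ ^ 2 * s)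
    (hsep1 : ∀ i j s, i ≠ j → T ≤ s → 1 ≤ ‖ξ i s - ξ j s‖)
    (hlip : ∀ i s s', T ≤ s → T ≤ s' → ‖ξ i s - ξ i s'‖ ≤ 2 * |s - s'|)
    (hc₀ : c₀ = (κ - κ ^ 2) / 2)
    (hlam : lam = ((16 : ℝ) ^ (N ^ 2 + 1))⁻¹)
    (hcρ : cρ = lam ^ 2 / 8)
    (hρ : ∀ s, ρ s = cρ * (Finset.fold min (c₀ * s) (fun pp ↦ ‖ξ (Prod.fst pp) s - ξ (Prod.snd pp) s‖) (Finset.offDiag Finset.univ)))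
    (hID : ∀ (t : ℝ) (c : E3) (R : ℝ) (A : Finset (Fin N)), T ≤ t → ρ t ≤ 1 / 8 * R →
      ‖c‖ + R ≤ (κ + κ ^ 2) / 2 * t →
      (∀ j, ‖ξ j t - c‖ ≤ (1 - 1 / 8) * R ∨ (1 + 1 / 8) * R ≤ ‖ξ j t - c‖) →
      (∀ j, j ∈ A ↔ ‖ξ j t - c‖ ≤ (1 - 1 / 8) * R) →
      |P t c R 0 - ∑ j ∈ A, M j * (√(1 - ‖v j t‖ ^ 2))⁻¹| ≤ ζ t ∧
      ∀ k : Fin 3, |P t c R k.succ - ∑ j ∈ A, M j * (√(1 - ‖v j t‖ ^ 2))⁻¹ * v j t k| ≤ ζ t)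
    (hζ0 : ∀ t, 0 ≤ ζ t)
    (hZ : ∀ t s, T ≤ t → t ≤ s → ζ s ≤ Z t)
    (ht₁ : T ≤ t₁) :
    ∃ σ : ℝ, 0 < σ ∧ (∀ i ∈ S, ∀ j ∈ S, ‖ξ i t₁ - ξ j t₁‖ < σ ∨ 16 * σ ≤ ‖ξ i t₁ - ξ j t₁‖) ∧
      16 * σ ≤ (Finset.fold min (c₀ * t₁) (fun pp ↦ ‖ξ (Prod.fst pp) t₁ - ξ (Prod.snd pp) t₁‖) (S ×ˢ Sᶜ)) ∧ lam * (Finset.fold min (c₀ * t₁) (fun pp ↦ ‖ξ (Prod.fst pp) t₁ - ξ (Prod.snd pp) t₁‖) (S ×ˢ Sᶜ)) ≤ σ ∧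
      ∀ μ : Fin 4, |∑ p ∈ (Finset.image (fun ii ↦ (dite (Finset.Nonempty (Finset.filter (fun jj ↦ ‖ξ ii t₁ - ξ jj t₁‖ < σ) S)) (fun hh ↦ Finset.min' (Finset.filter (fun jj ↦ ‖ξ ii t₁ - ξ jj t₁‖ < σ) S) hh) (fun _ ↦ ii))) S), P t₁ (ξ p t₁) (4 * σ) μ - (Fin.cons (∑ jj ∈ S, M jj * (√(1 - ‖v jj t₁‖ ^ 2))⁻¹) (fun kk ↦ ∑ jj ∈ S, M jj * (√(1 - ‖v jj t₁‖ ^ 2))⁻¹ * v jj t₁ kk) : Fin 4 → ℝ) μ| ≤ N * Z t₁ := by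
  have hc := c₀_pos_le hκ hκ1 hc₀
  obtain ⟨hl0, hl1⟩ := lam_pos_le hlam
  obtain ⟨-, hiso⟩ := isol_floor (S := S) hκ hκ1 hT1 hsep1 hc₀ ht₁ (le_refl t₁)
  obtain ⟨σ, hfl, hceil, hσ, hgap⟩ := exists_gap ξ t₁ S hiso
  have hσiso : 16 * σ ≤ (Finset.fold min (c₀ * t₁) (fun pp ↦ ‖ξ (Prod.fst pp) t₁ - ξ (Prod.snd pp) t₁‖) (S ×ˢ Sᶜ)) := by linarith [(le_div_iff₀ (by norm_num : (0:ℝ) < 16)).mp hceil]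
  have hlamσ : lam * (Finset.fold min (c₀ * t₁) (fun pp ↦ ‖ξ (Prod.fst pp) t₁ - ξ (Prod.snd pp) t₁‖) (S ×ˢ Sᶜ)) ≤ σ := floor_of_gap hlam hfl
  have hthr : ρ t₁ ≤ 1 / 8 * (4 * σ) := threshold_main hlip (by linarith [hc.2]) (by rw [hcρ]; positivity)
    (by rw [hcρ]; nlinarith) hρ ht₁ le_rfl (by linarith) hσ hσiso hlamσ
  obtain ⟨hadm, hmem, -, -⟩ := cover_facts hκ hκ1 (by linarith) hcone hlip hc₀ ht₁ le_rfl (by linarith) hσ hgap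
    hσiso hthr
  refine ⟨σ, hσ, hgap, hσiso, hlamσ, fun μ ↦ ?_⟩
  calc _ ≤ N * ζ t₁ := cover_identification hID ht₁ (hζ0 t₁) hadm hmem μ
    _ ≤ N * Z t₁ := by gcongr; exact hZ t₁ t₁ ht₁ le_rfl

/-- **ADVANCE**: one full step `σ/4` (static cost, re-covering through the refinement). [folklore] -/
theorem staircase_advance
    (hκ : 0 < κ)
    (hκ1 : κ < 1)
    (hT1 : 1 ≤ T)
    (hcone : ∀ i s, T ≤ s → ‖ξ i s‖ ≤ κ ^ 2 * s)
    (hsep1 : ∀ i j s, i ≠ j → T ≤ s → 1 ≤ ‖ξ i s - ξ j s‖)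
    (hlip : ∀ i s s', T ≤ s → T ≤ s' → ‖ξ i s - ξ i s'‖ ≤ 2 * |s - s'|)
    (hc₀ : c₀ = (κ - κ ^ 2) / 2)
    (hlam : lam = ((16 : ℝ) ^ (N ^ 2 + 1))⁻¹)
    (hcρ : cρ = lam ^ 2 / 8)
    (hρ : ∀ s, ρ s = cρ * (Finset.fold min (c₀ * s) (fun pp ↦ ‖ξ (Prod.fst pp) s - ξ (Prod.snd pp) s‖) (Finset.offDiag Finset.univ)))
    (hA : A = 2 / (lam * c₀))
    (hB : B = N * max C_W 0 * (A * √A) + 2 * (N * C_E * (2 * A * √A / lam)))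
   
    (hCE : 0 ≤ C_E)
    (hWL : ∀ (t₁ t₂ : ℝ) (c : ℝ → E3) (R : ℝ → ℝ), T ≤ t₁ → t₁ ≤ t₂ →
      (∀ s ∈ Set.Icc t₁ t₂, ∀ s' ∈ Set.Icc t₁ t₂, ‖c s - c s'‖ ≤ 2 * |s - s'| ∧ |R s - R s'| ≤ 2 * |s - s'|) →
      (∀ s ∈ Set.Icc t₁ t₂, ρ s ≤ 1 / 8 * R s ∧ ‖c s‖ + R s ≤ (κ + κ ^ 2) / 2 * s ∧
        ∀ j, ‖ξ j s - c s‖ ≤ (1 - 1 / 8) * R s ∨ (1 + 1 / 8) * R s ≤ ‖ξ j s - c s‖) →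
      ∀ μ : Fin 4, |P t₂ (c t₂) (R t₂) μ - P t₁ (c t₁) (R t₁) μ| ≤ C_W * ∫ s in t₁..t₂, (R s ^ (3 / 2 : ℝ))⁻¹)
    (hE : ∀ (t : ℝ) (c : E3) (R Rm : ℝ) (I : Finset (Fin N)) (c' : Fin N → E3) (R' : Fin N → ℝ), T ≤ t → 0 < Rm →
      ρ t ≤ 1 / 8 * Rm → Rm ≤ R → (∀ k ∈ I, Rm ≤ R' k) → ‖c‖ + R ≤ (κ + κ ^ 2) / 2 * t →
      (∀ j, ‖ξ j t - c‖ ≤ (1 - 1 / 8) * R ∨ (1 + 1 / 8) * R ≤ ‖ξ j t - c‖) →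
      (∀ k ∈ I, ∀ j, ‖ξ j t - c' k‖ ≤ (1 - 1 / 8) * R' k ∨ (1 + 1 / 8) * R' k ≤ ‖ξ j t - c' k‖) →
      (∀ k ∈ I, ‖c' k - c‖ + (1 + 1 / 8) * R' k ≤ (1 - 1 / 8) * R) →
      (∀ k ∈ I, ∀ l ∈ I, k ≠ l → (1 + 1 / 8) * (R' k + R' l) ≤ ‖c' k - c' l‖) →
      (∀ j, ‖ξ j t - c‖ ≤ (1 - 1 / 8) * R → ∃ k ∈ I, ‖ξ j t - c' k‖ ≤ (1 - 1 / 8) * R' k) →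
      ∀ μ : Fin 4, |P t c R μ - ∑ k ∈ I, P t (c' k) (R' k) μ| ≤ C_E * (√Rm)⁻¹)
    (ht₁ : T ≤ t₁)
    (hr : ∀ s ∈ Set.Icc t₁ t₂, 0 < r s ∧ ∀ i ∈ S, ∀ j ∉ S, r s ≤ ‖ξ i s - ξ j s‖)
    (hfi : ∀ a b, t₁ ≤ a → a ≤ b → b ≤ t₂ →
      IntervalIntegrable (fun s ↦ ((min (r s) s) ^ (3 / 2 : ℝ))⁻¹) volume a b)
    {s₀ σ : ℝ} (hs₀ : t₁ ≤ s₀) (hσ : 0 < σ)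
    (hgap : ∀ i ∈ S, ∀ j ∈ S, ‖ξ i s₀ - ξ j s₀‖ < σ ∨ 16 * σ ≤ ‖ξ i s₀ - ξ j s₀‖)
    (hσiso : 16 * σ ≤ (Finset.fold min (c₀ * s₀) (fun pp ↦ ‖ξ (Prod.fst pp) s₀ - ξ (Prod.snd pp) s₀‖) (S ×ˢ Sᶜ))) (hlamσ : lam * (Finset.fold min (c₀ * s₀) (fun pp ↦ ‖ξ (Prod.fst pp) s₀ - ξ (Prod.snd pp) s₀‖) (S ×ˢ Sᶜ)) ≤ σ)
    (hinv : ∀ μ : Fin 4, |∑ p ∈ (Finset.image (fun ii ↦ (dite (Finset.Nonempty (Finset.filter (fun jj ↦ ‖ξ ii s₀ - ξ jj s₀‖ < σ) S)) (fun hh ↦ Finset.min' (Finset.filter (fun jj ↦ ‖ξ ii s₀ - ξ jj s₀‖ < σ) S) hh) (fun _ ↦ ii))) S), P s₀ (ξ p s₀) (4 * σ) μ - (Fin.cons (∑ jj ∈ S, M jj * (√(1 - ‖v jj t₁‖ ^ 2))⁻¹) (fun kk ↦ ∑ jj ∈ S, M jj * (√(1 - ‖v jj t₁‖ ^ 2))⁻¹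 * v jj t₁ kk) : Fin 4 → ℝ) μ| ≤
      N * Z t₁ + B * ∫ s in t₁..s₀, ((min (r s) s) ^ (3 / 2 : ℝ))⁻¹)
    (hstep : s₀ + σ / 4 ≤ t₂) :
    ∃ σ₁ : ℝ, 0 < σ₁ ∧
      (∀ i ∈ S, ∀ j ∈ S, ‖ξ i (s₀ + σ / 4) - ξ j (s₀ + σ / 4)‖ < σ₁ ∨
        16 * σ₁ ≤ ‖ξ i (s₀ + σ / 4) - ξ j (s₀ + σ / 4)‖) ∧
      16 * σ₁ ≤ (Finset.fold min (c₀ * (s₀ + σ / 4)) (fun pp ↦ ‖ξ (Prod.fst pp) (s₀ + σ / 4) - ξ (Prod.snd pp) (s₀ + σ / 4)‖) (S ×ˢ Sᶜ)) ∧ lam * (Finset.fold min (c₀ * (s₀ + σ / 4)) (fun pp ↦ ‖ξ (Prod.fst pp) (s₀ + σ / 4) - ξ (Prod.snd pp) (s₀ + σ / 4)‖) (S ×ˢ Sᶜ)) ≤ σ₁ ∧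
      ∀ μ : Fin 4, |∑ p ∈ (Finset.image (fun ii ↦ (dite (Finset.Nonempty (Finset.filter (fun jj ↦ ‖ξ ii (s₀ + σ / 4) - ξ jj (s₀ + σ / 4)‖ < σ₁) S)) (fun hh ↦ Finset.min' (Finset.filter (fun jj ↦ ‖ξ ii (s₀ + σ / 4) - ξ jj (s₀ + σ / 4)‖ < σ₁) S) hh) (fun _ ↦ ii))) S), P (s₀ + σ / 4) (ξ p (s₀ + σ / 4)) (4 * σ₁) μ -
          (Fin.cons (∑ jj ∈ S, M jj * (√(1 - ‖v jj t₁‖ ^ 2))⁻¹) (fun kk ↦ ∑ jj ∈ S, M jj * (√(1 - ‖v jj t₁‖ ^ 2))⁻¹ * v jj t₁ kk) : Fin 4 → ℝ) μ| ≤ N * Z t₁ + B * ∫ s in t₁..(s₀ + σ / 4), ((min (r s) s) ^ (3 / 2 : ℝ))⁻¹ := by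
  have hc := c₀_pos_le hκ hκ1 hc₀
  obtain ⟨hl0, hl1⟩ := lam_pos_le hlam
  have hA1 := one_le_A hlam hA hc
  obtain ⟨hB0, -⟩ := B_bounds hκ hκ1 hc₀ hlam hA hB hCE
  set s₁ := s₀ + σ / 4 with hs₁
  have hT0 : 0 ≤ T := by linarith
  have hTs₀ : T ≤ s₀ := ht₁.trans hs₀
  have hs01 : s₀ ≤ s₁ := by rw [hs₁]; linarith
  have hs₁t : t₁ ≤ s₁ := hs₀.trans hs01
  have hcρ0 : 0 ≤ cρ := by rw [hcρ]; positivity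
  have hcρ2 : cρ ≤ lam ^ 2 / 4 := by rw [hcρ]; linarith [sq_nonneg lam]
  have hcρ1 : cρ ≤ lam / 4 := hcρ2.trans (by nlinarith)
  -- Lipschitz control of the isolation scale over the step
  have hlipS : ∀ s ∈ Set.Icc s₀ s₁, (Finset.fold min (c₀ * s) (fun pp ↦ ‖ξ (Prod.fst pp) s - ξ (Prod.snd pp) s‖) (S ×ˢ Sᶜ)) ≤ (Finset.fold min (c₀ * s₀) (fun pp ↦ ‖ξ (Prod.fst pp) s₀ - ξ (Prod.snd pp) s₀‖) (S ×ˢ Sᶜ)) + 4 * (s - s₀) := fun s hs ↦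
    isol_le_isol_add hs.1 (by linarith [hc.2]) fun i ↦ hlip i s₀ s hTs₀ (hTs₀.trans hs.1)
  have hup : (Finset.fold min (c₀ * s₁) (fun pp ↦ ‖ξ (Prod.fst pp) s₁ - ξ (Prod.snd pp) s₁‖) (S ×ˢ Sᶜ)) ≤ (Finset.fold min (c₀ * s₀) (fun pp ↦ ‖ξ (Prod.fst pp) s₀ - ξ (Prod.snd pp) s₀‖) (S ×ˢ Sᶜ)) + σ := by
    have := hlipS s₁ ⟨hs01, le_rfl⟩; rw [hs₁] at this ⊢; linarith
  have hiso₁ : 0 < (Finset.fold min (c₀ * s₁) (fun pp ↦ ‖ξ (Prod.fst pp) s₁ - ξ (Prod.snd pp) s₁‖) (S ×ˢ Sᶜ)) := (isol_floor (S := S) hκ hκ1 hT1 hsep1 hc₀ ht₁ hs₁t).2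
  -- the new cover and the refinement
  obtain ⟨σ₁, hfl₁, hceil₁, hσ₁, hgap₁⟩ := exists_gap ξ s₁ S hiso₁
  have hσiso₁ : 16 * σ₁ ≤ (Finset.fold min (c₀ * s₁) (fun pp ↦ ‖ξ (Prod.fst pp) s₁ - ξ (Prod.snd pp) s₁‖) (S ×ˢ Sᶜ)) := by
    linarith [(le_div_iff₀ (by norm_num : (0:ℝ) < 16)).mp hceil₁]
  have hlamσ₁ : lam * (Finset.fold min (c₀ * s₁) (fun pp ↦ ‖ξ (Prod.fst pp) s₁ - ξ (Prod.snd pp) s₁‖) (S ×ˢ Sᶜ)) ≤ σ₁ := floor_of_gap hlam hfl₁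
  have hmin : 0 < min σ σ₁ := lt_min hσ hσ₁
  obtain ⟨σr, hflr, hceilr, hσr, hgapr⟩ := exists_gap ξ s₁ S hmin
  have hlamσr : lam * min σ σ₁ ≤ σr := floor_of_gap hlam hflr
  have hσrσ : σr ≤ σ / 16 := hceilr.trans (by gcongr; exact min_le_left _ _)
  have hσrσ₁ : σr ≤ σ₁ / 16 := hceilr.trans (by gcongr; exact min_le_right _ _)
  have hσisor : 16 * σr ≤ (Finset.fold min (c₀ * s₁) (fun pp ↦ ‖ξ (Prod.fst pp) s₁ - ξ (Prod.snd pp) s₁‖) (S ×ˢ Sᶜ)) := by linarith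
  -- thresholds
  have hthr : ∀ s ∈ Set.Icc s₀ s₁, ρ s ≤ 1 / 8 * (4 * σ) := fun s hs ↦
    threshold_main hlip (by linarith [hc.2]) hcρ0 hcρ1 hρ hTs₀ hs.1 hs.2 hσ hσiso hlamσ
  have hthr₁ : ρ s₁ ≤ 1 / 8 * (4 * σ₁) :=
    threshold_main hlip (by linarith [hc.2]) hcρ0 hcρ1 hρ (hTs₀.trans hs01) le_rfl (by linarith) hσ₁ hσiso₁ hlamσ₁
  have hthrr : ρ s₁ ≤ 1 / 8 * (4 * σr) :=
    threshold_refinement hcρ0 hcρ2 hρ hl0 hl1 hlamσ hlamσ₁ hlamσr hup hiso₁.le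
  -- cover facts: old cover along the step, new cover and refinement at `s₁`
  have hF₀ := fun s (hs : s ∈ Set.Icc s₀ s₁) ↦
    cover_facts (ρ := ρ) hκ hκ1 hT0 hcone hlip hc₀ hTs₀ hs.1 hs.2 hσ hgap hσiso (hthr s hs)
  obtain ⟨hadm₀, -, hins₀, hcls₀⟩ := hF₀ s₁ ⟨hs01, le_rfl⟩
  obtain ⟨hadm₁, -, hins₁, hcls₁⟩ :=
    cover_facts (ρ := ρ) hκ hκ1 hT0 hcone hlip hc₀ (hTs₀.trans hs01) le_rfl (by linarith) hσ₁ hgap₁ hσiso₁ hthr₁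
  obtain ⟨hadmr, -, -, -⟩ :=
    cover_facts (ρ := ρ) hκ hκ1 hT0 hcone hlip hc₀ (hTs₀.trans hs01) le_rfl (by linarith) hσr hgapr hσisor hthrr
  -- compatibility of the refinement with the old and the new classes
  have hcompat₀ : ∀ j ∈ S, (dite (Finset.Nonempty (Finset.filter (fun jj ↦ ‖ξ (dite (Finset.Nonempty (Finset.filter (fun jj ↦ ‖ξ j s₁ - ξ jj s₁‖ < σr) S)) (fun hh ↦ Finset.min' (Finset.filter (fun jj ↦ ‖ξ j s₁ - ξ jj s₁‖ < σr) S) hh) (fun _ ↦ j)) s₀ - ξ jj s₀‖ < σ) S)) (fun hh ↦ Finset.min' (Finset.filter (fun jj ↦ ‖ξ (dite (Finset.Nonempty (Finset.filter (fun jj ↦ ‖ξ j s₁ - ξ jj s₁‖ < σr) S)) (fun hh ↦ Finset.min' (Finset.filter (fun jj ↦ ‖ξ j s₁ - ξ jj s₁‖ < σr) S) hh) (fun _ ↦ j)) s₀ - ξ jj s₀‖ < σ) S) hh) (fun _ ↦ (dite (Finset.Nonempty (Finset.filter (fun jj ↦ ‖ξ j s₁ - ξ jj s₁‖ < σr) S))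 (fun hh ↦ Finset.min' (Finset.filter (fun jj ↦ ‖ξ j s₁ - ξ jj s₁‖ < σr) S) hh) (fun _ ↦ j)))) = (dite (Finset.Nonempty (Finset.filter (fun jj ↦ ‖ξ j s₀ - ξ jj s₀‖ < σ) S)) (fun hh ↦ Finset.min' (Finset.filter (fun jj ↦ ‖ξ j s₀ - ξ jj s₀‖ < σ) S) hh) (fun _ ↦ j)) := by
    intro j hj
    have hq : (dite (Finset.Nonempty (Finset.filter (fun jj ↦ ‖ξ j s₁ - ξ jj s₁‖ < σr) S)) (fun hh ↦ Finset.min' (Finset.filter (fun jj ↦ ‖ξ j s₁ - ξ jj s₁‖ < σr) S) hh) (fun _ ↦ j)) ∈ S := rep_mem hσr hj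
    rw [rep_eq_iff hσ hgap hq hj]
    have h1 : ‖ξ j s₁ - ξ ((dite (Finset.Nonempty (Finset.filter (fun jj ↦ ‖ξ j s₁ - ξ jj s₁‖ < σr) S)) (fun hh ↦ Finset.min' (Finset.filter (fun jj ↦ ‖ξ j s₁ - ξ jj s₁‖ < σr) S) hh) (fun _ ↦ j))) s₁‖ < σr := norm_sub_rep_lt (ξ := ξ) (s := s₁) hσr hj
    have h2 := hlip j s₀ s₁ hTs₀ (hTs₀.trans hs01)
    have h3 := hlip ((dite (Finset.Nonempty (Finset.filter (fun jj ↦ ‖ξ j s₁ - ξ jj s₁‖ < σr) S)) (fun hh ↦ Finset.min' (Finset.filter (fun jj ↦ ‖ξ j s₁ - ξ jj s₁‖ < σr) S) hh) (fun _ ↦ j))) s₀ s₁ hTs₀ (hTs₀.trans hs01)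
    have habs : |s₀ - s₁| = σ / 4 := by rw [hs₁, abs_sub_comm, abs_of_nonneg (by linarith)]; ring
    rw [habs] at h2 h3
    have h4 : ‖ξ ((dite (Finset.Nonempty (Finset.filter (fun jj ↦ ‖ξ j s₁ - ξ jj s₁‖ < σr) S)) (fun hh ↦ Finset.min' (Finset.filter (fun jj ↦ ‖ξ j s₁ - ξ jj s₁‖ < σr) S) hh) (fun _ ↦ j))) s₀ - ξ j s₀‖ < 16 * σ := by
      have e := calc ‖ξ ((dite (Finset.Nonempty (Finset.filter (fun jj ↦ ‖ξ j s₁ - ξ jj s₁‖ < σr) S)) (fun hh ↦ Finset.min' (Finset.filter (fun jj ↦ ‖ξ j s₁ - ξ jj s₁‖ < σr) S) hh) (fun _ ↦ j))) s₀ - ξ j s₀‖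
          = ‖(ξ ((dite (Finset.Nonempty (Finset.filter (fun jj ↦ ‖ξ j s₁ - ξ jj s₁‖ < σr) S)) (fun hh ↦ Finset.min' (Finset.filter (fun jj ↦ ‖ξ j s₁ - ξ jj s₁‖ < σr) S) hh) (fun _ ↦ j))) s₀ - ξ ((dite (Finset.Nonempty (Finset.filter (fun jj ↦ ‖ξ j s₁ - ξ jj s₁‖ < σr) S)) (fun hh ↦ Finset.min' (Finset.filter (fun jj ↦ ‖ξ j s₁ - ξ jj s₁‖ < σr) S) hh) (fun _ ↦ j))) s₁) - (ξ j s₀ - ξ j s₁) -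
              (ξ j s₁ - ξ ((dite (Finset.Nonempty (Finset.filter (fun jj ↦ ‖ξ j s₁ - ξ jj s₁‖ < σr) S)) (fun hh ↦ Finset.min' (Finset.filter (fun jj ↦ ‖ξ j s₁ - ξ jj s₁‖ < σr) S) hh) (fun _ ↦ j))) s₁)‖ := by congr 1; abel
        _ ≤ ‖(ξ ((dite (Finset.Nonempty (Finset.filter (fun jj ↦ ‖ξ j s₁ - ξ jj s₁‖ < σr) S)) (fun hh ↦ Finset.min' (Finset.filter (fun jj ↦ ‖ξ j s₁ - ξ jj s₁‖ < σr) S) hh) (fun _ ↦ j))) s₀ - ξ ((dite (Finset.Nonempty (Finset.filter (fun jj ↦ ‖ξ j s₁ - ξ jj s₁‖ < σr) S)) (fun hh ↦ Finset.min' (Finset.filter (fun jj ↦ ‖ξ j s₁ - ξ jj s₁‖ < σr) S) hh) (fun _ ↦ j))) s₁) - (ξ j s₀ - ξ j s₁)‖ +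
              ‖ξ j s₁ - ξ ((dite (Finset.Nonempty (Finset.filter (fun jj ↦ ‖ξ j s₁ - ξ jj s₁‖ < σr) S)) (fun hh ↦ Finset.min' (Finset.filter (fun jj ↦ ‖ξ j s₁ - ξ jj s₁‖ < σr) S) hh) (fun _ ↦ j))) s₁‖ := norm_sub_le _ _
        _ ≤ ‖ξ ((dite (Finset.Nonempty (Finset.filter (fun jj ↦ ‖ξ j s₁ - ξ jj s₁‖ < σr) S)) (fun hh ↦ Finset.min' (Finset.filter (fun jj ↦ ‖ξ j s₁ - ξ jj s₁‖ < σr) S) hh) (fun _ ↦ j))) s₀ - ξ ((dite (Finset.Nonempty (Finset.filter (fun jj ↦ ‖ξ j s₁ - ξ jj s₁‖ < σr) S)) (fun hh ↦ Finset.min' (Finset.filter (fun jj ↦ ‖ξ j s₁ - ξ jj s₁‖ < σr) S) hh) (fun _ ↦ j))) s₁‖ + ‖ξ j s₀ - ξ j s₁‖ +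
              ‖ξ j s₁ - ξ ((dite (Finset.Nonempty (Finset.filter (fun jj ↦ ‖ξ j s₁ - ξ jj s₁‖ < σr) S)) (fun hh ↦ Finset.min' (Finset.filter (fun jj ↦ ‖ξ j s₁ - ξ jj s₁‖ < σr) S) hh) (fun _ ↦ j))) s₁‖ := by gcongr; exact norm_sub_le _ _
      linarith
    rcases hgap _ hq j hj with h | h
    · exact h
    · exact absurd h4 (not_lt.mpr h)
  have hcompat₁ : ∀ j ∈ S, (dite (Finset.Nonempty (Finset.filter (fun jj ↦ ‖ξ (dite (Finset.Nonempty (Finset.filter (fun jj ↦ ‖ξ j s₁ - ξ jj s₁‖ < σr) S)) (fun hh ↦ Finset.min' (Finset.filter (fun jj ↦ ‖ξ j s₁ - ξ jj s₁‖ < σr) S) hh) (fun _ ↦ j)) s₁ - ξ jj s₁‖ < σ₁) S)) (fun hh ↦ Finset.min' (Finset.filter (fun jj ↦ ‖ξ (dite (Finset.Nonempty (Finset.filter (fun jj ↦ ‖ξ j s₁ - ξ jj s₁‖ < σr) S)) (fun hh ↦ Finset.min' (Finset.filter (fun jj ↦ ‖ξ j s₁ - ξ jj s₁‖ < σr) S)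 hh) (fun _ ↦ j)) s₁ - ξ jj s₁‖ < σ₁) S) hh) (fun _ ↦ (dite (Finset.Nonempty (Finset.filter (fun jj ↦ ‖ξ j s₁ - ξ jj s₁‖ < σr) S)) (fun hh ↦ Finset.min' (Finset.filter (fun jj ↦ ‖ξ j s₁ - ξ jj s₁‖ < σr) S) hh) (fun _ ↦ j)))) = (dite (Finset.Nonempty (Finset.filter (fun jj ↦ ‖ξ j s₁ - ξ jj s₁‖ < σ₁) S)) (fun hh ↦ Finset.min' (Finset.filter (fun jj ↦ ‖ξ j s₁ - ξ jj s₁‖ < σ₁) S) hh) (fun _ ↦ j)) := by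
    intro j hj
    have hq : (dite (Finset.Nonempty (Finset.filter (fun jj ↦ ‖ξ j s₁ - ξ jj s₁‖ < σr) S)) (fun hh ↦ Finset.min' (Finset.filter (fun jj ↦ ‖ξ j s₁ - ξ jj s₁‖ < σr) S) hh) (fun _ ↦ j)) ∈ S := rep_mem hσr hj
    rw [rep_eq_iff hσ₁ hgap₁ hq hj, norm_sub_rev]
    have h1 : ‖ξ j s₁ - ξ ((dite (Finset.Nonempty (Finset.filter (fun jj ↦ ‖ξ j s₁ - ξ jj s₁‖ < σr) S)) (fun hh ↦ Finset.min' (Finset.filter (fun jj ↦ ‖ξ j s₁ - ξ jj s₁‖ < σr) S) hh) (fun _ ↦ j))) s₁‖ < σr := norm_sub_rep_lt (ξ := ξ) (s := s₁) hσr hj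
    linarith
  -- the three costs
  have hstatic := static_cost hWL hTs₀ hs01 hσ (card_reps_le (ξ := ξ) (s := s₀) (S := S) (σ := σ))
    (fun s hs p hp ↦ (hF₀ s hs).1 p hp)
  have hE₁ := fun (c : E3) (R Rm : ℝ) (I : Finset (Fin N)) (c' : Fin N → E3) (R' : Fin N → ℝ) ↦
    hE s₁ c R Rm I c' R' (hTs₀.trans hs01)
  have hsw₀ := switch_cost hE₁ hCE hσr hσrσ
    (fun p hp ↦ ⟨(hadm₀ p hp).2.1, (hadm₀ p hp).2.2⟩) hins₀ hcls₀ hgapr hthrr (fun q hq ↦ (hadmr q hq).2.2) hcompat₀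
  have hsw₁ := switch_cost hE₁ hCE hσr hσrσ₁
    (fun p hp ↦ ⟨(hadm₁ p hp).2.1, (hadm₁ p hp).2.2⟩) hins₁ hcls₁ hgapr hthrr (fun q hq ↦ (hadmr q hq).2.2) hcompat₁
  -- the step integral dominates the costs
  have hfstep : IntervalIntegrable (fun s ↦ ((min (r s) s) ^ (3 / 2 : ℝ))⁻¹) volume s₀ s₁ :=
    hfi s₀ s₁ hs₀ hs01 hstep
  have hAσ : 0 < A * σ := by positivity
  have hlow : ∀ s ∈ Set.Icc s₀ s₁, ((A * σ) ^ (3 / 2 : ℝ))⁻¹ ≤ ((min (r s) s) ^ (3 / 2 : ℝ))⁻¹ := fun s hs ↦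
    integrand_lower hc.1 hc.2 hl0 hA hσ hs.1 hs.2 hσiso hlamσ (hlipS s hs) (hr s ⟨hs₀.trans hs.1, hs.2.trans hstep⟩).1
      (hr s ⟨hs₀.trans hs.1, hs.2.trans hstep⟩).2
  have hJ := integral_lower hs01 hAσ hfstep hlow
  have hJ0 : 0 ≤ (s₁ - s₀) * (A * σ * √(A * σ))⁻¹ := by
    have : 0 ≤ s₁ - s₀ := by linarith
    positivity
  have hst' : (s₁ - s₀) * ((4 * σ) ^ (3 / 2 : ℝ))⁻¹ ≤ A * √A * ((s₁ - s₀) * (A * σ * √(A * σ))⁻¹) :=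
    static_le_integral hs01 hA1 hσ
  have hσrlam : lam ^ 2 * σ ≤ σr := by
    have hlowS : (Finset.fold min (c₀ * s₀) (fun pp ↦ ‖ξ (Prod.fst pp) s₀ - ξ (Prod.snd pp) s₀‖) (S ×ˢ Sᶜ)) - 4 * (s₁ - s₀) ≤ (Finset.fold min (c₀ * s₁) (fun pp ↦ ‖ξ (Prod.fst pp) s₁ - ξ (Prod.snd pp) s₁‖) (S ×ˢ Sᶜ)) :=
      isol_sub_le_isol hs01 hc.1.le fun i ↦ hlip i s₀ s₁ hTs₀ (hTs₀.trans hs01)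
    have e0 : (Finset.fold min (c₀ * s₀) (fun pp ↦ ‖ξ (Prod.fst pp) s₀ - ξ (Prod.snd pp) s₀‖) (S ×ˢ Sᶜ)) - σ ≤ (Finset.fold min (c₀ * s₁) (fun pp ↦ ‖ξ (Prod.fst pp) s₁ - ξ (Prod.snd pp) s₁‖) (S ×ˢ Sᶜ)) := by rw [hs₁] at hlowS; linarith
    have e1 : lam * σ ≤ σ₁ :=
      calc lam * σ ≤ lam * ((Finset.fold min (c₀ * s₀) (fun pp ↦ ‖ξ (Prod.fst pp) s₀ - ξ (Prod.snd pp) s₀‖) (S ×ˢ Sᶜ)) - σ) := mul_le_mul_of_nonneg_left (by linarith) hl0.le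
        _ ≤ lam * (Finset.fold min (c₀ * s₁) (fun pp ↦ ‖ξ (Prod.fst pp) s₁ - ξ (Prod.snd pp) s₁‖) (S ×ˢ Sᶜ)) := mul_le_mul_of_nonneg_left e0 hl0.le
        _ ≤ σ₁ := hlamσ₁
    have e2 : lam * σ ≤ σ := mul_le_of_le_one_left hσ.le hl1
    have e3 : lam * σ ≤ min σ σ₁ := le_min e2 e1
    calc lam ^ 2 * σ = lam * (lam * σ) := by ring
      _ ≤ lam * min σ σ₁ := mul_le_mul_of_nonneg_left e3 hl0.le
      _ ≤ σr := hlamσr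
  have hsw' : (√(4 * σr))⁻¹ ≤ 2 * A * √A / lam * ((s₁ - s₀) * (A * σ * √(A * σ))⁻¹) :=
    switch_le_integral (by rw [hs₁]; ring) hA1 hσ hl0 hσrlam
  have hcost : N * max C_W 0 * (s₁ - s₀) * ((4 * σ) ^ (3 / 2 : ℝ))⁻¹ + N * C_E * (√(4 * σr))⁻¹ +
      N * C_E * (√(4 * σr))⁻¹ ≤ B * ∫ s in s₀..s₁, ((min (r s) s) ^ (3 / 2 : ℝ))⁻¹ := by
    have e1 : N * max C_W 0 * (s₁ - s₀) * ((4 * σ) ^ (3 / 2 : ℝ))⁻¹ ≤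
        N * max C_W 0 * (A * √A * ((s₁ - s₀) * (A * σ * √(A * σ))⁻¹)) := by
      rw [mul_assoc (N * max C_W 0 : ℝ)]; exact mul_le_mul_of_nonneg_left hst' (by positivity)
    have e2 : N * C_E * (√(4 * σr))⁻¹ ≤ N * C_E * (2 * A * √A / lam * ((s₁ - s₀) * (A * σ * √(A * σ))⁻¹)) :=
      mul_le_mul_of_nonneg_left hsw' (by positivity)
    have e3 : B * ((s₁ - s₀) * (A * σ * √(A * σ))⁻¹) ≤ B * ∫ s in s₀..s₁, ((min (r s) s) ^ (3 / 2 : ℝ))⁻¹ :=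
      mul_le_mul_of_nonneg_left hJ hB0
    have e4 : N * max C_W 0 * (A * √A * ((s₁ - s₀) * (A * σ * √(A * σ))⁻¹)) +
        N * C_E * (2 * A * √A / lam * ((s₁ - s₀) * (A * σ * √(A * σ))⁻¹)) +
        N * C_E * (2 * A * √A / lam * ((s₁ - s₀) * (A * σ * √(A * σ))⁻¹)) =
        B * ((s₁ - s₀) * (A * σ * √(A * σ))⁻¹) := by rw [hB]; ring
    linarith
  -- additivity of the integral
  have hadd : ∫ s in t₁..s₁, ((min (r s) s) ^ (3 / 2 : ℝ))⁻¹ =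
      (∫ s in t₁..s₀, ((min (r s) s) ^ (3 / 2 : ℝ))⁻¹) + ∫ s in s₀..s₁, ((min (r s) s) ^ (3 / 2 : ℝ))⁻¹ :=
    (intervalIntegral.integral_add_adjacent_intervals (hfi t₁ s₀ le_rfl hs₀ (hs01.trans hstep)) hfstep).symm
  refine ⟨σ₁, hσ₁, hgap₁, hσiso₁, hlamσ₁, fun μ ↦ ?_⟩
  have h1 := hinv μ
  have h2 := hstatic μ
  have h3 := hsw₀ μ
  have h4 := hsw₁ μ
  rw [hadd, mul_add]
  rw [abs_le] at h1 h2 h3 h4 ⊢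
  constructor <;> linarith

/-- Registered one-line form (carrier `c0_pos_le_sce12` of the crux item) of `c₀_pos_le`. [folklore] -/
theorem c0_pos_le_sce12 : ∀ (κ c₀ : ℝ), 0 < κ → κ < 1 → c₀ = (κ - κ ^ 2) / 2 → 0 < c₀ ∧ c₀ ≤ 1 :=
  fun _ _ hκ hκ1 hc₀ ↦ c₀_pos_le hκ hκ1 hc₀

end Summit.FinalStateConjecture.FinalStateConjecture.Theorems.SublinearIsFree.Staircase

end
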